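import Literature.IUT.LogThetaLattice.ThetaLinkOfKits
import Literature.IUT.LogThetaLattice.StripFrameOfKitsToy

/-!
# Non-vacuity: a `ThetaLinkKit` over abc-iut-L5-t4's TOY kits, hence `ThetaLinkData.ofKits` inhabited ([IUTchII] Cor 4.10 (i)(ii)(iv))

Mochizuki, *Inter-universal Teichmüller Theory II*, kurims manuscript (Dec 2020), Cor 4.10 (i)–(iv) pp. 158–160;
*III* (May 2020), Thm 1.5 (ii) p. 48. ([IUTchII] Cor 4.10 (iv) p.160) [claim: Mochizuki2012, status: disputed].
abc-iut cell, wave 5, seat abc-iut-w5-d132 — KIT-RULE consistency witness (plan/L6 ASSIGNMENTS G11/G12) complementing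
abc-iut-L6-t3's `StripFrameOfKitsToy.lean` (p414080), which inhabits `StripFrame.ofKits` / `LogStripData.ofKits` /
Prop 1.2 (i) over the toy kits but NOT the Cor 4.10 input structure `ThetaLinkKit` of `ThetaLinkOfKits.lean` (p413818;
audit note INFO-1 of this seat, STATUS 01:2xZ).  Over the toy `TimesMuSide` (`KitsToy.timesMuSide`: the
`F^{⊢×μ}`-prime-strip category is the ONE-OBJECT groupoid `SingleObj Unit` of the toy `𝒟^⊢`-kit), the three pilot-strip
functors can all be taken CONSTANT at the model `ℱ^⊩`-prime-strip, the unit-portion isomorphisms the identity, and the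
Cor 4.10 (iv) clause `induced_full` ("coincides with the full poly-isomorphism") HOLDS because the target groupoid has a
single isomorphism (so `F^{⊩▶×μ} ↦ F^{⊢×μ}` is trivially Isom-surjective there):

* `KitsToy.frStrip` — the model `ℱ^⊩`-prime-strip over the toy kit;
* `KitsToy.thetaLinkKit` — a `ThetaLinkKit (KitsToy.timesMuSide l hl)`;
* `KitsToy.thetaLinkData` — `ThetaLinkData.ofKits` over the toy frame, and `KitsToy.linkInducedFxm_full` — [IUTchIII]
  Thm 1.5 (ii) ("horizontal coricity") holds, non-vacuously, for any two Hodge theaters of the toy frame.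

NOT provided (and not obtainable over a FINITE toy): an injective `ℤ × ℤ`-family of `Θ^{±ell}`-Hodge theaters, so
`LogThetaLatticeDiagram.ofKits` / `lgpSkeletonOfKits` (Def 1.4 demands pairwise DISTINCT theaters) are not instantiated
here.  Nothing of the series is asserted; consistency ≠ endorsement; no side taken on [IUTchIII] Cor 3.12.
-/

noncomputable section

namespace Literature.IUT.LogThetaLattice

open CategoryTheory
open Literature.IUT.HodgeTheaters Literature.IUT.HodgeTheaters.PMBaseKit

namespace KitsToy

variable (l : ℕ) [Fact l.Prime] (hl : l ≠ 2)

/-- **IUTchI:Def5.2(iv)** (kurims p.135) The MODEL `ℱ^⊩`-prime-strip over the toy kit (collection of data = the model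
collection `rlfModel`, condition (f) by the identity). ([IUTchI] Def 5.2 (iv) p.135) [claim: Mochizuki2012, status: disputed] -/
def frStrip : (FKit.toy l hl).FrStrip := ⟨(FKit.toy l hl).rlfModel, ⟨Iso.refl _⟩⟩

/-- **IUTchII:Cor4.10(iv)** (kurims p.160) In the toy `F^{⊢×μ}`-prime-strip category (`SingleObj Unit`) any two
isomorphisms between the same objects coincide. ([IUTchII] Cor 4.10 (iv) p.160) [claim: Mochizuki2012, status: disputed] -/
theorem iso_eq_of_timesMuSide_Fxm {A B : (timesMuSide l hl).Fxm} (e e' : A ≅ B) : e = e' :=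
  Iso.ext rfl

/-- **IUTchII:Cor4.10(i)** (kurims p.158) **A `ThetaLinkKit` over the toy kits**: `†HT ↦ †F^{⊩▶×μ}_△`, `†F^{⊩▶×μ}_{env}`,
`†F^{⊩▶×μ}_{gau}` all CONSTANT at the model `ℱ^⊩`-prime-strip; unit-portion isomorphisms the identity (Cor 4.10 (iv),
first clause); "coincides with the full poly-isomorphism" (Cor 4.10 (iv), second clause) because the toy
`F^{⊢×μ}`-groupoid has exactly one isomorphism between any two objects. ([IUTchII] Cor 4.10 (i) p.158)
[claim: Mochizuki2012, status: disputed] -/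
def thetaLinkKit : ThetaLinkKit (timesMuSide l hl) where
  pilotDelta := (Functor.const _).obj (frStrip l hl)
  pilotTheta _ := (Functor.const _).obj (frStrip l hl)
  unitPortion _ := Iso.refl _
  induced_full k H H' := by
    rw [← Literature.IUT.HodgeArakelov.mapIso_surjective_iff_map_full]
    intro e
    exact ⟨Iso.refl _, iso_eq_of_timesMuSide_Fxm l hl _ _⟩

/-- **IUTchII:Cor4.10(iii)** (kurims p.160) **`ThetaLinkData.ofKits` is inhabited**: the [IUTchIII] §1 horizontal-arrow
interface over the toy frame `KitsToy.frame` (= `StripFrame.ofKits` over the toy kits), from the toy `ThetaLinkKit`.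
([IUTchII] Cor 4.10 (iii) p.160) [claim: Mochizuki2012, status: disputed] -/
def thetaLinkData : ThetaLinkData (frame l hl) :=
  ThetaLinkData.ofKits (FKit.MonoLaws.toy l hl) (FKit.isomFtoDBijective_toy l hl)
    (FKit.isomFmtoDmSurjective_toy l hl) (FKit.rlfOfIsStrip_toy l hl) (timesMuSide l hl) (thetaLinkKit l hl)

/-- **IUTchIII:Thm1.5(ii)** (kurims p.48) Thm 1.5 (ii) ("horizontal coricity": the `Θ^{×μ}`- or `Θ^{×μ}_{gau}`-link induces the
FULL poly-isomorphism of associated `F^{⊢×μ}`-prime-strips) holds, NON-VACUOUSLY, for every pair of Hodge theaters of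
the toy frame (e.g. two copies of `KitsToy.thetaPMEllHT`). ([IUTchIII] Thm 1.5 (ii) p.48)
[claim: Mochizuki2012, status: disputed] -/
theorem linkInducedFxm_full (k : LatticeKind) (X Y : (frame l hl).HT) :
    (thetaLinkData l hl).linkInducedFxm k X Y = PolyIso.full _ _ :=
  (thetaLinkData l hl).linkInducedFxm_full k X Y

/-- **IUTchII:Cor4.10(iii)** (kurims p.160) The toy frame has (at least) the two Hodge theaters needed to draw one
`Θ^{×μ}`-link: its Hodge-theater category is inhabited (abc-iut-L6-t3's `nonempty_HT`), and the link between any two of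
its objects is the full poly-isomorphism by definition. ([IUTchII] Cor 4.10 (iii) p.160) [claim: Mochizuki2012, status: disputed] -/
theorem link_eq_full (k : LatticeKind) (X Y : (frame l hl).HT) :
    (thetaLinkData l hl).link k X Y = PolyIso.full _ _ := rfl

end KitsToy

end Literature.IUT.LogThetaLattice

end
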